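import Literature.Topology.FourManifolds.EuclideanRegularDomain
import Literature.Topology.FourManifolds.RegularSublevelAmbient

/-!
# Smooth functions on a compact regular domain `{F ≤ 0} ⊆ ℝ^{m+1}` extend to `ℝ^{m+1}` (Seeley)

Topic `Literature/Topology/FourManifolds` (infrastructure for the fact seat
`provefact-Literature.Geometry.Riemannian.LawsonMichelsohn1984_surrounding`: the Morse function
of the domain `D = {F ≤ 0}` — an abstract smooth function on the manifold with boundary
`IsRegularCompactDomain.Domain` — has to be read as a smooth function on all of `ℝ^{m+1}` to
drive the gradient collar of the endgame, `MeanConvexSurroundingEndgame.lean`).  Everything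
here is **proved**.

* `IsRegularCompactDomain.exists_contDiff_forall_eq` — for `h : IsRegularCompactDomain F` every
  `C^∞` function `φ : h.Domain → ℝ` (manifold-with-boundary sense) is the restriction of a `C^∞`
  function on `ℝ^{m+1}`: the tree's Seeley extension for closed regular domains with a
  half-slice atlas (`HalfSliceAtlas.exists_contMDiff_forall_eq'`, `RegularSublevelAmbient.lean`)
  applied to the domain as a regular sublevel set of the half-space-charted `ℝ^{m+1}`, followed
  by the identification of smooth functions on `HalfSpaceCharted ℝ^{m+1}` with those on
  `ℝ^{m+1}` (`HalfSpaceCharted.contMDiff_iff`).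

## References

* R. T. Seeley, *Extension of `C^∞` functions defined in a half space*, Proc. AMS 15 (1964),
  625–626. [Seeley1964]
* J. M. Lee, *Introduction to Smooth Manifolds*, 2nd ed. (2013), Lemma 2.26, Thm. 5.48.
  [LeeSmoothManifolds2013]
-/

noncomputable section

open Set Function
open scoped Manifold ContDiff

namespace Literature.Topology.FourManifolds

namespace IsRegularCompactDomain

open HalfSpaceCharted

variable {m : ℕ} {F : EuclideanSpace ℝ (Fin (m + 1)) → ℝ}

/-- **Seeley extension for the compact regular domain `{F ≤ 0}`**: every smooth real function
on the domain (as a manifold with boundary) is the restriction of a smooth function on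
`ℝ^{m+1}`. [cite: Seeley1964, Theorem] [cite: LeeSmoothManifolds2013, Lemma 2.26] -/
theorem exists_contDiff_forall_eq (h : IsRegularCompactDomain F) {φ : h.Domain → ℝ}
    (hφ : ContMDiff (𝓡∂ (m + 1)) 𝓘(ℝ, ℝ) ∞ φ) :
    ∃ Φ : EuclideanSpace ℝ (Fin (m + 1)) → ℝ, ContDiff ℝ ∞ Φ ∧
      ∀ p : h.Domain, Φ (Domain.incl h p) = φ p := by
  haveI : SigmaCompactSpace (HalfSpaceCharted (EuclideanSpace ℝ (Fin (m + 1)))) :=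
    inferInstanceAs (SigmaCompactSpace (EuclideanSpace ℝ (Fin (m + 1))))
  have hS : IsClosed ((F ∘ (of (X := EuclideanSpace ℝ (Fin (m + 1)))).symm) ⁻¹' Iic 0) :=
    isClosed_Iic.preimage h.contMDiff_comp_symm.continuous
  obtain ⟨G, hG, hGφ⟩ := h.atlas.exists_contMDiff_forall_eq' hS (g := φ) hφ
  refine ⟨G ∘ of, ?_, fun p => hGφ p⟩
  have h1 : ContMDiff (𝓡 (m + 1)) 𝓘(ℝ, ℝ) ∞ (G ∘ of) :=
    (contMDiff_iff (n := m) (X := EuclideanSpace ℝ (Fin (m + 1))) (f := G ∘ of)).1 hG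
  exact contMDiff_iff_contDiff.1 h1

end IsRegularCompactDomain

end Literature.Topology.FourManifolds

end
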